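import Summits.QuantumFields.BalabanUV.Beta.EriceRemainderEnclosureHistoryAutonomyComparisonDefectUniformEnclosure

/-!
# EriceRemainderEnclosureHistoryAutonomyComparisonDefectPseudoOrbit — (E140i) **PSEUDO-ORBITS ARE ENCLOSED: no perturbed functional is needed, only that the LEVEL
# INCREMENTS of the sequence stay within `ε` of the structured memory read on its own tails** — so the enclosure of (E140h) applies verbatim to NON-AUTONOMOUS,
# scale-dependent flows (a family `B′_m`, one functional per scale, each `ε`-close to `B`), which is the shape of a finite-depth history-dependent recursion before any
# limit functional exists.  STATEMENT (`pseudo_orbit_enclosure`): `B` isotone on `]0,γ]^ℕ`, zeroth moment `M`, floor `b`, `B ≤ β̄`, level-Lipschitz age profile `Λ` on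
# `range K` over the box graded by `b − ε`, `θ = Σ_k k·Λ_k < 1`; `h′` ANY box sequence from the pin `p` with
#     **`|1∕h′_{m+1}² − 1∕h′_m² − B(h′_{m+1}, h′_{m+2}, …)| ≤ ε`  for every `m`**  (`0 ≤ ε < b`);
# `h₋, h₊` box solutions of `B − ε`, `B + ε` from `p`.  Then for every `j`: **`1∕h₋_j² − c ≤ 1∕h′_j² ≤ 1∕h₊_j² + c`, `c = (K−1)θ·2ε∕(1−θ)`.**  COROLLARIES: the
# non-autonomous flow `1∕h′_{m+1}² = 1∕h′_m² + B′_m(tail)` with `|B′_m − B| ≤ ε` for all `m` (`nonautonomous_enclosure`); and the exact side: increments exceeding the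
# base's by `∈ [ε_lo, ε_hi]` with `θ·ε_hi ≤ ε_lo` put the pseudo-orbit BELOW the base orbit (`pseudo_orbit_le`, from (E140a)).
# THE TRICK: along a strictly decreasing sequence the tails `(h′_{m+1+j})_j` are pairwise distinct, so the increments DEFINE a functional `B″` on them (and `B″ := B`
# elsewhere): `h′` IS a `MemFlow` orbit of `B″`, and `|B″ − B| ≤ ε` on the whole box (`exists_functional_of_pseudo_orbit`).  Scale-dependence costs nothing in this framework.

Cell `pub-balaban`, β-function sub-cell, BINDER row D4 «RemainderConst leaves for Bałaban's split» (`HOME/BINDER-OWNERS.md`; owner lineage `b2b-balaban-beta-an4`;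
this file by co-owner #2 lineage `b2b-balaban-beta-d4-p2`, generation 108), β-FLOW TEAM duty (1), FREEZE (0) honoured (def-free: `B″` is an existential witness built from
a displayed `dite` lambda; (E140h) `enclosure_uniform`, (E140a) `le_of_two_sided_excess` BY NAME; nothing restated).

HONEST FRAMING (page 1, verbatim and binding).  *"Discharging BetaPertH makes Bałaban's UV stability UNCONDITIONAL — a real constructive-QFT result; it is
NOT the continuum limit and NOT the Clay problem."*  THIS FILE DISCHARGES NOTHING OF THE KIND.  Elementary real analysis about ABSTRACT functionals and sequences on a
box ]0,γ]^ℕ (node U2's `MemFlow` ∕ `SeqBox`) — hypotheses of a census, not facts: whether Bałaban's scale-`k` β-functionals (1.22) are `ε`-close to ONE structured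
(isotone, level-Lipschitz, `θ < 1`) functional is NOT PRINTED ([I] p. 298; GAPS G-t4-U2-1∕-2: «NO statement on the k-dependence of β_{k+1}») and NOT asserted.  Row D4 class
UNCHANGED (critical-path width 0; instance 0∕1; D4 DISCHARGE NO DATE).  NOT B12 Thm 2, NOT BetaPertH, NOT continuum YM, NOT Clay.

WHAT IS PROVED ([folklore]; 0 `def`, 0 sorry).  §1 `strictAnti_of_increments`, `tail_injective`, **`exists_functional_of_pseudo_orbit`**.  §2 **`pseudo_orbit_enclosure`**,
**`nonautonomous_enclosure`**, **`pseudo_orbit_le`**.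
-/

noncomputable section
open Finset Set

namespace Summit.QuantumFields.BalabanUV.Beta.EriceRemainderEnclosureHistoryAutonomyComparisonDefectPseudoOrbit

open Literature.MathematicalPhysics.QuantumFieldTheory.Balaban1983to89
open Literature.MathematicalPhysics.QuantumFieldTheory.Balaban1983to89.T4BetaStationary
open Literature.MathematicalPhysics.QuantumFieldTheory.Balaban1983to89.T4BetaFlowWellPosed
open Summit.QuantumFields.BalabanUV.Beta.EriceRemainderEnclosureHistoryAutonomyComparisonDefect (le_of_two_sided_excess)
open Summit.QuantumFields.BalabanUV.Beta.EriceRemainderEnclosureHistoryAutonomyComparisonDefectUniformEnclosure (enclosure_uniform)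

variable {B : (ℕ → ℝ) → ℝ} {M γ b : ℝ} {h h' hlo hup : ℕ → ℝ}

/-! ## §1 A pseudo-orbit is an orbit of SOME nearby functional -/

/-- A positive sequence whose levels `1∕h′_m²` strictly increase is strictly decreasing. [folklore] -/
theorem strictAnti_of_increments (hpos : ∀ m, 0 < h' m) (hinc : ∀ m, 1 / h' m ^ 2 < 1 / h' (m + 1) ^ 2) : StrictAnti h' := by
  refine strictAnti_nat_of_succ_lt fun m => ?_
  have h1 : h' (m + 1) ^ 2 < h' m ^ 2 := (one_div_lt_one_div (pow_pos (hpos m) 2) (pow_pos (hpos (m + 1)) 2)).mp (hinc m)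
  exact lt_of_pow_lt_pow_left₀ 2 (hpos m).le h1

/-- Along a strictly decreasing sequence the tails `(h′_{m+1+j})_j` are pairwise distinct. [folklore] -/
theorem tail_injective (hanti : StrictAnti h') {m m' : ℕ} (he : (fun j => h' (m + 1 + j)) = (fun j => h' (m' + 1 + j))) : m = m' := by
  have h0 := congrFun he 0
  simp only [add_zero] at h0
  have := hanti.injective h0
  omega

/-- **A PSEUDO-ORBIT IS AN ORBIT OF SOME FUNCTIONAL WITH THE PRESCRIBED INCREMENTS ON ITS TAILS AND `B` ELSEWHERE**: for a strictly decreasing `h′` and any increments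
`g`, there is `B″` with `B″(h′_{m+1}, h′_{m+2}, …) = g m` for every `m` and `B″ u = B u` off the tails (classical choice on the distinct tails). [folklore] -/
theorem exists_functional_of_pseudo_orbit (hanti : StrictAnti h') (g : ℕ → ℝ) (B₀ : (ℕ → ℝ) → ℝ) :
    ∃ B'' : (ℕ → ℝ) → ℝ, (∀ m, B'' (fun j => h' (m + 1 + j)) = g m)
      ∧ (∀ u, (¬ ∃ m, u = fun j => h' (m + 1 + j)) → B'' u = B₀ u) := by
  classical
  refine ⟨fun u => if hu : ∃ m, u = fun j => h' (m + 1 + j) then g (Classical.choose hu) else B₀ u, fun m => ?_, fun u hu => ?_⟩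
  · have hu : ∃ m', (fun j => h' (m + 1 + j)) = fun j => h' (m' + 1 + j) := ⟨m, rfl⟩
    simp only [dif_pos hu]
    have hspec := Classical.choose_spec hu
    rw [← tail_injective hanti hspec]
  · simp only [dif_neg hu]

/-! ## §2 Enclosure and comparison of pseudo-orbits -/

/-- **PSEUDO-ORBIT ENCLOSURE.**  `B`: isotone on the box `]0,γ]^ℕ`, zeroth moment `M`, floor `b`, `B ≤ β̄`, level-Lipschitz age profile `Λ ≥ 0` on `range K` over the box graded
by `b − ε`, `θ := Σ_{k<K} k·Λ_k < 1`.  `h′`: ANY box sequence with `h′ 0 = p` and **`|1∕h′_{m+1}² − 1∕h′_m² − B(h′_{m+1}, h′_{m+2}, …)| ≤ ε`** for all `m` (`0 ≤ ε < b`) — an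
`ε`-pseudo-orbit of `B`; NO functional of which `h′` is an orbit is assumed.  `h₋, h₊`: box solutions of `B − ε`, `B + ε` from `p`.  Then with `c := (K−1)·θ·2ε∕(1−θ)`:
**`1∕h₋_j² − c ≤ 1∕h′_j² ≤ 1∕h₊_j² + c` at every `j`** — (E140h) `enclosure_uniform` for the functional `B″` of `exists_functional_of_pseudo_orbit`. [folklore] -/
theorem pseudo_orbit_enclosure {Λ : ℕ → ℝ} {K : ℕ} {βb p ε : ℝ}
    (hmono : ∀ u v : ℕ → ℝ, SeqBox γ u → SeqBox γ v → (∀ i, u i ≤ v i) → B u ≤ B v)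
    (hB : ∀ u u' : ℕ → ℝ, SeqBox γ u → SeqBox γ u' → ∀ D : ℝ, (∀ j, |u j - u' j| ≤ D) → |B u - B u'| ≤ M * D) (hM : 0 ≤ M)
    (hε : 0 ≤ ε) (hεb : ε < b) (hlow : ∀ u, SeqBox γ u → b ≤ B u) (hbdd : ∀ u, SeqBox γ u → B u ≤ βb)
    (hΛ : ∀ k, 0 ≤ Λ k) (hθ : ∑ k ∈ range K, (k : ℝ) * Λ k < 1)
    (hLip : ∀ u v : ℕ → ℝ, SeqBox γ u → SeqBox γ v → (∀ k : ℕ, 1 / γ ^ 2 + ((k : ℝ) + 1) * (b - ε) ≤ 1 / u k ^ 2) →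
      (∀ k : ℕ, 1 / γ ^ 2 + ((k : ℝ) + 1) * (b - ε) ≤ 1 / v k ^ 2) → B u - B v ≤ ∑ k ∈ range K, Λ k * max (1 / v k ^ 2 - 1 / u k ^ 2) 0)
    (hp : 0 < p) (hpγ : p ≤ γ) (hhlo : SeqBox γ hlo) (hflo : MemFlow (fun w => B w + -ε) p hlo)
    (hhup : SeqBox γ hup) (hfup : MemFlow (fun w => B w + ε) p hup)
    (hh' : SeqBox γ h') (hp0 : h' 0 = p)
    (hps : ∀ m, |1 / h' (m + 1) ^ 2 - 1 / h' m ^ 2 - B (fun j => h' (m + 1 + j))| ≤ ε) (j : ℕ) :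
    1 / hlo j ^ 2 - ((K - 1 : ℕ) : ℝ) * ((∑ k ∈ range K, (k : ℝ) * Λ k) * (2 * ε) / (1 - ∑ k ∈ range K, (k : ℝ) * Λ k)) ≤ 1 / h' j ^ 2
      ∧ 1 / h' j ^ 2 ≤ 1 / hup j ^ 2 + ((K - 1 : ℕ) : ℝ) * ((∑ k ∈ range K, (k : ℝ) * Λ k) * (2 * ε) / (1 - ∑ k ∈ range K, (k : ℝ) * Λ k)) := by
  -- the pseudo-orbit is strictly decreasing (increments ≥ b − ε > 0)
  have hinc : ∀ m, 1 / h' m ^ 2 < 1 / h' (m + 1) ^ 2 := fun m => by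
    have h1 := (abs_le.mp (hps m)).1
    have h2 := hlow _ (fun j => hh' (m + 1 + j))
    linarith
  have hanti := strictAnti_of_increments (fun m => (hh' m).1) hinc
  -- the functional B″: the increments on the tails, B elsewhere
  obtain ⟨B'', htail, hoff⟩ := exists_functional_of_pseudo_orbit hanti (fun m => 1 / h' (m + 1) ^ 2 - 1 / h' m ^ 2) B
  have hf' : MemFlow B'' p h' := ⟨hp0, fun m => by rw [htail m]; ring⟩
  have hpert : ∀ u, SeqBox γ u → |B'' u - B u| ≤ ε := by
    intro u _
    by_cases hu : ∃ m, u = fun j => h' (m + 1 + j)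
    · obtain ⟨m, rfl⟩ := hu
      rw [htail m]
      exact hps m
    · rw [hoff u hu, sub_self, abs_zero]
      exact hε
  exact enclosure_uniform hmono hB hM hε hεb hlow hbdd hΛ hθ hLip hpert hp hpγ hhlo hflo hhup hfup hh' hf' j

/-- **NON-AUTONOMOUS ENCLOSURE**: a SCALE-DEPENDENT family of functionals `B′_m`, each `ε`-close to the structured `B` on the box (`|B′_m u − B u| ≤ ε`), and a box sequence
`h′` solving the non-autonomous flow `1∕h′_{m+1}² = 1∕h′_m² + B′_m(h′_{m+1}, h′_{m+2}, …)` from the pin `p`: the same enclosure between the orbits of `B ∓ ε`.  (The shape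
of a finite-depth history-dependent recursion with one β-functional per scale.) [folklore] -/
theorem nonautonomous_enclosure {Λ : ℕ → ℝ} {K : ℕ} {βb p ε : ℝ} {B' : ℕ → (ℕ → ℝ) → ℝ}
    (hmono : ∀ u v : ℕ → ℝ, SeqBox γ u → SeqBox γ v → (∀ i, u i ≤ v i) → B u ≤ B v)
    (hB : ∀ u u' : ℕ → ℝ, SeqBox γ u → SeqBox γ u' → ∀ D : ℝ, (∀ j, |u j - u' j| ≤ D) → |B u - B u'| ≤ M * D) (hM : 0 ≤ M)
    (hε : 0 ≤ ε) (hεb : ε < b) (hlow : ∀ u, SeqBox γ u → b ≤ B u) (hbdd : ∀ u, SeqBox γ u → B u ≤ βb)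
    (hΛ : ∀ k, 0 ≤ Λ k) (hθ : ∑ k ∈ range K, (k : ℝ) * Λ k < 1)
    (hLip : ∀ u v : ℕ → ℝ, SeqBox γ u → SeqBox γ v → (∀ k : ℕ, 1 / γ ^ 2 + ((k : ℝ) + 1) * (b - ε) ≤ 1 / u k ^ 2) →
      (∀ k : ℕ, 1 / γ ^ 2 + ((k : ℝ) + 1) * (b - ε) ≤ 1 / v k ^ 2) → B u - B v ≤ ∑ k ∈ range K, Λ k * max (1 / v k ^ 2 - 1 / u k ^ 2) 0)
    (hclose : ∀ m, ∀ u, SeqBox γ u → |B' m u - B u| ≤ ε)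
    (hp : 0 < p) (hpγ : p ≤ γ) (hhlo : SeqBox γ hlo) (hflo : MemFlow (fun w => B w + -ε) p hlo)
    (hhup : SeqBox γ hup) (hfup : MemFlow (fun w => B w + ε) p hup)
    (hh' : SeqBox γ h') (hp0 : h' 0 = p) (hflow : ∀ m, 1 / h' (m + 1) ^ 2 = 1 / h' m ^ 2 + B' m (fun j => h' (m + 1 + j))) (j : ℕ) :
    1 / hlo j ^ 2 - ((K - 1 : ℕ) : ℝ) * ((∑ k ∈ range K, (k : ℝ) * Λ k) * (2 * ε) / (1 - ∑ k ∈ range K, (k : ℝ) * Λ k)) ≤ 1 / h' j ^ 2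
      ∧ 1 / h' j ^ 2 ≤ 1 / hup j ^ 2 + ((K - 1 : ℕ) : ℝ) * ((∑ k ∈ range K, (k : ℝ) * Λ k) * (2 * ε) / (1 - ∑ k ∈ range K, (k : ℝ) * Λ k)) := by
  refine pseudo_orbit_enclosure hmono hB hM hε hεb hlow hbdd hΛ hθ hLip hp hpγ hhlo hflo hhup hfup hh' hp0 (fun m => ?_) j
  have e : 1 / h' (m + 1) ^ 2 - 1 / h' m ^ 2 - B (fun j => h' (m + 1 + j)) = B' m (fun j => h' (m + 1 + j)) - B (fun j => h' (m + 1 + j)) := by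
    rw [hflow m]; ring
  rw [e]
  exact hclose m _ fun j => hh' (m + 1 + j)

/-- **PSEUDO-ORBIT COMPARISON (the exact side).**  `B`: isotone on `]0,γ]^ℕ`, zeroth moment `M`, floor `b > 0`, level-Lipschitz age profile `Λ ≥ 0` on `range K` over the graded
box (grading `b`), `θ := Σ_{k<K} k·Λ_k`.  `h′`: ANY box sequence from the pin `p` whose increments EXCEED the base's by a two-sided amount,
**`ε_lo ≤ 1∕h′_{m+1}² − 1∕h′_m² − B(h′_{m+1}, …) ≤ ε_hi`** for all `m`, with `ε_lo > 0` and **`θ·ε_hi ≤ ε_lo`**; `h` the box solution of `B` from `p`.  Then `h′ ≤ h` at every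
scale — (E140a) `le_of_two_sided_excess` for the functional that is the increment on the tails and `B + ε_lo` elsewhere. [folklore] -/
theorem pseudo_orbit_le {Λ : ℕ → ℝ} {K : ℕ} {βb p εlo εhi : ℝ}
    (hmono : ∀ u v : ℕ → ℝ, SeqBox γ u → SeqBox γ v → (∀ i, u i ≤ v i) → B u ≤ B v)
    (hB : ∀ u u' : ℕ → ℝ, SeqBox γ u → SeqBox γ u' → ∀ D : ℝ, (∀ j, |u j - u' j| ≤ D) → |B u - B u'| ≤ M * D) (hM : 0 ≤ M)
    (hb : 0 < b) (hlo : ∀ u, SeqBox γ u → b ≤ B u) (hbdd : ∀ u, SeqBox γ u → B u ≤ βb)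
    (hΛ : ∀ k, 0 ≤ Λ k) (hεlo : 0 < εlo) (hθε : (∑ k ∈ range K, (k : ℝ) * Λ k) * εhi ≤ εlo)
    (hLip : ∀ u v : ℕ → ℝ, SeqBox γ u → SeqBox γ v → (∀ k : ℕ, 1 / γ ^ 2 + ((k : ℝ) + 1) * b ≤ 1 / u k ^ 2) →
      (∀ k : ℕ, 1 / γ ^ 2 + ((k : ℝ) + 1) * b ≤ 1 / v k ^ 2) → B u - B v ≤ ∑ k ∈ range K, Λ k * max (1 / v k ^ 2 - 1 / u k ^ 2) 0)
    (hp : 0 < p) (hpγ : p ≤ γ) (hh : SeqBox γ h) (hf : MemFlow B p h)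
    (hh' : SeqBox γ h') (hp0 : h' 0 = p)
    (hps : ∀ m, εlo ≤ 1 / h' (m + 1) ^ 2 - 1 / h' m ^ 2 - B (fun j => h' (m + 1 + j))
      ∧ 1 / h' (m + 1) ^ 2 - 1 / h' m ^ 2 - B (fun j => h' (m + 1 + j)) ≤ εhi) (j : ℕ) :
    h' j ≤ h j := by
  have hlohi : εlo ≤ εhi := (hps 0).1.trans (hps 0).2
  -- strictly decreasing: increments ≥ b + ε_lo > 0
  have hinc : ∀ m, 1 / h' m ^ 2 < 1 / h' (m + 1) ^ 2 := fun m => by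
    have h1 := (hps m).1
    have h2 := hlo _ (fun j => hh' (m + 1 + j))
    linarith
  have hanti := strictAnti_of_increments (fun m => (hh' m).1) hinc
  obtain ⟨B'', htail, hoff⟩ := exists_functional_of_pseudo_orbit hanti (fun m => 1 / h' (m + 1) ^ 2 - 1 / h' m ^ 2) (fun u => B u + εlo)
  have hf' : MemFlow B'' p h' := ⟨hp0, fun m => by rw [htail m]; ring⟩
  have htwo : ∀ u, SeqBox γ u → εlo ≤ B'' u - B u ∧ B'' u - B u ≤ εhi := by
    intro u _
    by_cases hu : ∃ m, u = fun j => h' (m + 1 + j)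
    · obtain ⟨m, rfl⟩ := hu
      rw [htail m]
      exact hps m
    · rw [hoff u hu]
      constructor <;> linarith
  have hbdd' : ∀ u, SeqBox γ u → B'' u ≤ βb + εhi := fun u hu => by linarith [(htwo u hu).2, hbdd u hu]
  exact le_of_two_sided_excess hmono hB hM hb hlo hΛ hεlo hθε hLip htwo hbdd' hp hpγ hh hf hh' hf' j

end Summit.QuantumFields.BalabanUV.Beta.EriceRemainderEnclosureHistoryAutonomyComparisonDefectPseudoOrbit

end
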